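import Summits.CriticalPhenomena.PercolationContinuityZ3.Theorems.NonProliferation.Negative.AboveSix
import Summits.CriticalPhenomena.PercolationContinuityZ3.Theorems.PercNonProliferationNonProliferationDimTwo
import Literature.Barriers.CriticalPhenomena.GaussianDominationRoute
import Literature.Barriers.CriticalPhenomena.GaussianDominationRouteXSpace
import Literature.Barriers.CriticalPhenomena.GaussianDominationRouteInfraredBoundHolds
import Literature.Probability.Percolation.KestenTheoremProofs
import Literature.Probability.Percolation.CriticalContinuity
import Literature.Probability.Percolation.HalfSpacePinnedPairs
import Literature.Probability.Percolation.PercolationProofs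
import Literature.Probability.Percolation.ConnectivityProofs
import HarnessLib

/-!
# Crux `PercNonProliferation.NonProliferation` (stmt-CriticalPhenomena-4444) — calibration of the
# load-bearing stub S1 of line `jump-fragmentation` ACROSS DIMENSIONS: S1 does not flip where the crux flips

Lead c8 of line `jump-fragmentation`. Lands with `--supports stmt-CriticalPhenomena-4444`; closes nothing by itself;
no definitions (the `d`-dimensional form of the stub

  S1(d) := `∃ M c>0, ∃ᶠ n, P_{p_c(ℤ^d)}(no M+1 PERCOLATING points of B(n) pairwise unjoined inside B(2n)) ≥ c`

is spelled out wherever it occurs; S1(3) is the registered stub `stub_infiniteClusterFewClasses` verbatim).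

The crux is, verbatim, the `d = 3` member of the family `∃ M c>0, ∃ᶠ n, c ≤ P_{p_c(ℤ^d)}((repEvent d M n)ᶜ)`
(`Negative.nonProliferation_iff`), and that family is TRUE at `d = 2`
(`DimTwo.nonProliferationDim_two`) and FALSE for every `d ≥ 7` under Aizenman's two-point condition (t-c)
(`Negative.nonProliferation_false_of_twoPointBoundedRatio`): the barrier `SpanningClustersAboveSix`. The line's
card claims that its load-bearing stub S1 is NOT of this kind — it holds wherever `θ(p_c) = 0` is a theorem. This
file makes that claim kernel-checked:

* `real_fewClassesEvent_eq_one_of_percolationContinuity` — the engine: `θ(p_c(ℤ^d)) = 0` makes S1(d)'s event (with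
  `M = 0`) ALMOST SURE at every scale (no point percolates, by translation invariance and a union bound over `B(n)`).
* `fewClassesDim_of_percolationContinuity` — hence `PercolationContinuity d → S1(d)` (`M = 0`, `c = 1`, all `n`).
* `fewClassesDim_two` — **S1(2) holds** (Harris–Kesten: `p_c(ℤ²) = 1/2`, `θ(1/2) = 0`, both PROVED in the tree).
* `fewClassesDim_and_not_nonProliferationDim` — **for every `d ≥ 7` satisfying (t-c) with `η = 0`, S1(d) holds AND the
  `d`-dimensional crux fails**: the two statements part ways exactly above the upper critical dimension.
* `fewClassesDim_and_not_nonProliferationDim_of_hara` — the same for every `d ≥ 11`, granted the named fact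
  `Hara2008_etaZeroXSpace` (Heydenreich–van der Hofstad, Thm. 11.4).
* `exists_forall_fewClassesDim` — **unconditionally, S1(d) holds for all sufficiently large `d`** (Hara–Slade infrared
  bound, PROVED in the tree as `HaraSlade1990_infraredBound_holds`, ⟹ `θ(p_c) = 0` for `d ≥ d₀`).

So the wall that killed the three crux-plan lines of this crux (an input false in `d ≥ 7`) provably does not stand in
front of S1; S1's wall is sprinkling-free finite-volume uniqueness of a hypothetical critical infinite cluster
(barrier `SprinklingRenormalisation`), and its `d = 3` case is exactly what route `PercNonProliferation` consumes
(`continuity_of_freeBoxSparse_of_fewClasses`, landed).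

References: M. Aizenman, Nucl. Phys. B 485 (1997), Thms. 3–4 [Aizenman1997]; T. Hara, G. Slade, Comm. Math. Phys. 128
(1990) [HaraSlade1990]; M. Heydenreich, R. van der Hofstad (2017), Thms. 5.1, 11.4 [HeydenreichVanDerHofstad2017];
H. Kesten, Comm. Math. Phys. 74 (1980) [KestenCMP1980]; T. E. Harris, Proc. Camb. Phil. Soc. 56 (1960) [HarrisPCPS1960].
-/

noncomputable section

namespace Summit.CriticalPhenomena.PercolationContinuityZ3.Theorems.NonProliferation

open MeasureTheory Filter Topology
open Literature.Probability.LatticeModels Literature.Probability.Percolation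
open Literature.Barriers.CriticalPhenomena
open Summit.CriticalPhenomena.PercolationContinuityZ3.Theorems.NonProliferation.Negative

/-- **Engine.** If `θ(p_c(ℤ^d)) = 0` then, at every scale `n`, with probability one there is NO percolating point of
`B(n)` at all — in particular S1(d)'s event with `M = 0` is almost sure: it fails only on
`⋃_{x ∈ B(n)} {x ↔ ∞}`, a finite union of null sets (`θ_x = θ_0 = 0` by translation invariance). -/
theorem real_fewClassesEvent_eq_one_of_percolationContinuity {d : ℕ} (h : PercolationContinuity d) (n : ℕ) :
    (bondPercolation (zdGraph d) (criticalProbI d)).real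
      {ω | ¬ ∃ x : Fin (0 + 1) → Site d, (∀ i, x i ∈ box d n) ∧ (∀ i, ω ∈ percolatesAt (x i)) ∧
        ∀ i j, i ≠ j → ω ∉ openConnIn (↑(box d (2 * n)) : Set (Site d)) (x i) (x j)} = 1 := by
  set μ : Measure (BondConfig (Site d)) := bondPercolation (zdGraph d) (criticalProbI d) with hμ
  have h0 : theta (zdGraph d) (0 : Site d) (criticalProbI d) = 0 := h
  -- every site percolates with probability `θ = 0` (translation invariance)
  have hx0 : ∀ x : Site d, μ.real (percolatesAt x) = 0 := by
    intro x
    have := theta_zdGraph_eq_theta_zero (d := d) (criticalProbI d) x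
    unfold theta at this h0
    rw [hμ, this, h0]
  -- the bad event is contained in `⋃_{x ∈ B(n)} {x percolates}`, a null set
  have hbad : μ.real {ω | ∃ x : Fin (0 + 1) → Site d, (∀ i, x i ∈ box d n) ∧ (∀ i, ω ∈ percolatesAt (x i)) ∧
      ∀ i j, i ≠ j → ω ∉ openConnIn (↑(box d (2 * n)) : Set (Site d)) (x i) (x j)} = 0 := by
    refine le_antisymm ?_ measureReal_nonneg
    calc μ.real _ ≤ μ.real (⋃ x ∈ box d n, percolatesAt x) := by
          refine measureReal_mono ?_ (measure_ne_top _ _)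
          rintro ω ⟨x, hx, hperc, -⟩
          exact Set.mem_biUnion (hx 0) (hperc 0)
      _ ≤ ∑ x ∈ box d n, μ.real (percolatesAt x) := measureReal_biUnion_finset_le _ _
      _ = 0 := Finset.sum_eq_zero fun x _ => hx0 x
  have hmeas : MeasurableSet {ω : BondConfig (Site d) | ∃ x : Fin (0 + 1) → Site d, (∀ i, x i ∈ box d n) ∧
      (∀ i, ω ∈ percolatesAt (x i)) ∧
      ∀ i j, i ≠ j → ω ∉ openConnIn (↑(box d (2 * n)) : Set (Site d)) (x i) (x j)} := by
    refine measurableSet_setOf.2 (Measurable.exists fun x => ?_)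
    refine measurable_const.and ((Measurable.forall fun i => ?_).and
      (Measurable.forall fun i => Measurable.forall fun j => measurable_const.imp ?_))
    · exact (measurableSet_percolatesAt_holds (x i)).mem
    · exact (measurableSet_openConnIn_of_countable _ (x i) (x j)).mem.not
  have hcompl := probReal_compl_eq_one_sub (μ := μ) hmeas
  rw [hbad, sub_zero] at hcompl
  rw [show {ω : BondConfig (Site d) | ¬ ∃ x : Fin (0 + 1) → Site d, (∀ i, x i ∈ box d n) ∧
      (∀ i, ω ∈ percolatesAt (x i)) ∧
      ∀ i j, i ≠ j → ω ∉ openConnIn (↑(box d (2 * n)) : Set (Site d)) (x i) (x j)} =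
    {ω : BondConfig (Site d) | ∃ x : Fin (0 + 1) → Site d, (∀ i, x i ∈ box d n) ∧
      (∀ i, ω ∈ percolatesAt (x i)) ∧
      ∀ i j, i ≠ j → ω ∉ openConnIn (↑(box d (2 * n)) : Set (Site d)) (x i) (x j)}ᶜ from rfl, hcompl]

/-- **`θ(p_c(ℤ^d)) = 0 ⟹ S1(d)`** (with `M = 0`, `c = 1`, and in fact at EVERY scale). -/
theorem fewClassesDim_of_percolationContinuity {d : ℕ} (h : PercolationContinuity d) :
    ∃ (M : ℕ) (c : ℝ), 0 < c ∧ ∃ᶠ n : ℕ in atTop, c ≤ (bondPercolation (zdGraph d) (criticalProbI d)).real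
      {ω | ¬ ∃ x : Fin (M + 1) → Site d, (∀ i, x i ∈ box d n) ∧ (∀ i, ω ∈ percolatesAt (x i)) ∧
        ∀ i j, i ≠ j → ω ∉ openConnIn (↑(box d (2 * n)) : Set (Site d)) (x i) (x j)} :=
  ⟨0, 1, one_pos, Frequently.of_forall fun n =>
    (real_fewClassesEvent_eq_one_of_percolationContinuity h n).symm.le⟩

/-- **S1(2) holds**: on `ℤ²`, `p_c = 1/2` (Kesten) and `θ(1/2) = 0` (Harris), both proved in the tree
(`kesten_criticalProb_Z2_holds`, `harris_theta_half_holds`), so the two-dimensional form of the stub is true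
(`M = 0`, `c = 1`). Together with `DimTwo.nonProliferationDim_two`: at `d = 2` stub AND crux hold.
[cite: KestenCMP1980, Thm. 2 (1.6)] [cite: HarrisPCPS1960, main theorem] -/
theorem fewClassesDim_two :
    ∃ (M : ℕ) (c : ℝ), 0 < c ∧ ∃ᶠ n : ℕ in atTop, c ≤ (bondPercolation (zdGraph 2) (criticalProbI 2)).real
      {ω | ¬ ∃ x : Fin (M + 1) → Site 2, (∀ i, x i ∈ box 2 n) ∧ (∀ i, ω ∈ percolatesAt (x i)) ∧
        ∀ i j, i ≠ j → ω ∉ openConnIn (↑(box 2 (2 * n)) : Set (Site 2)) (x i) (x j)} :=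
  fewClassesDim_of_percolationContinuity (percolationContinuity_two kesten_criticalProb_Z2_holds harris_theta_half_holds)

/-- **Stub and crux at `d = 2`: both true.** [cite: Aizenman1997, Thm. 3] -/
theorem fewClassesDim_two_and_nonProliferationDim_two :
    (∃ (M : ℕ) (c : ℝ), 0 < c ∧ ∃ᶠ n : ℕ in atTop, c ≤ (bondPercolation (zdGraph 2) (criticalProbI 2)).real
      {ω | ¬ ∃ x : Fin (M + 1) → Site 2, (∀ i, x i ∈ box 2 n) ∧ (∀ i, ω ∈ percolatesAt (x i)) ∧
        ∀ i j, i ≠ j → ω ∉ openConnIn (↑(box 2 (2 * n)) : Set (Site 2)) (x i) (x j)}) ∧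
    (∃ (M : ℕ) (c : ℝ), 0 < c ∧ ∃ᶠ n : ℕ in atTop,
        c ≤ (bondPercolation (zdGraph 2) (criticalProbI 2)).real (repEvent 2 M n)ᶜ) :=
  ⟨fewClassesDim_two, DimTwo.nonProliferationDim_two⟩

/-- **ABOVE SIX DIMENSIONS THE STUB AND THE CRUX PART WAYS.** For every `d ≥ 7` satisfying Aizenman's two-point
condition (t-c) with `η = 0` (`TwoPointBoundedRatio d`): the `d`-dimensional stub S1(d) HOLDS (because (t-c) gives
`θ(p_c) = 0`, `TwoPointBoundedRatio.percolationContinuity`) while the `d`-dimensional crux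
FAILS (Aizenman 1997, Thm. 4 (3): the annulus-spanning clusters proliferate, `nonProliferation_false_of_twoPointBoundedRatio`).
So no proof of S1 is forced to use an input that is false above six dimensions — the barrier
`SpanningClustersAboveSix` does not bite the load-bearing stub of line `jump-fragmentation`.
[cite: Aizenman1997, Thm. 4 (3)] [cite: HeydenreichVanDerHofstad2017, (1.2.14) and p. 48] -/
theorem fewClassesDim_and_not_nonProliferationDim :
    ∀ d : ℕ, 6 < d → TwoPointBoundedRatio d →
      (∃ (M : ℕ) (c : ℝ), 0 < c ∧ ∃ᶠ n : ℕ in atTop, c ≤ (bondPercolation (zdGraph d) (criticalProbI d)).real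
        {ω | ¬ ∃ x : Fin (M + 1) → Site d, (∀ i, x i ∈ box d n) ∧ (∀ i, ω ∈ percolatesAt (x i)) ∧
          ∀ i j, i ≠ j → ω ∉ openConnIn (↑(box d (2 * n)) : Set (Site d)) (x i) (x j)}) ∧
      ¬ (∃ (M : ℕ) (c : ℝ), 0 < c ∧ ∃ᶠ n : ℕ in atTop,
        c ≤ (bondPercolation (zdGraph d) (criticalProbI d)).real (repEvent d M n)ᶜ) := by
  intro d hd hτ
  haveI : NeZero d := ⟨by omega⟩
  exact ⟨fewClassesDim_of_percolationContinuity (hτ.percolationContinuity (by omega)),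
    nonProliferation_false_of_twoPointBoundedRatio hd hτ⟩

/-- **The same for every `d ≥ 11`, granted Hara's `η = 0` in `x`-space** (named fact `Hara2008_etaZeroXSpace`,
Heydenreich–van der Hofstad 2017, Thm. 11.4): S1(d) holds and the `d`-dimensional crux fails.
[cite: HeydenreichVanDerHofstad2017, Thm. 11.4] -/
theorem fewClassesDim_and_not_nonProliferationDim_of_hara (hH : Hara2008_etaZeroXSpace) {d : ℕ} (hd : 11 ≤ d) :
    (∃ (M : ℕ) (c : ℝ), 0 < c ∧ ∃ᶠ n : ℕ in atTop, c ≤ (bondPercolation (zdGraph d) (criticalProbI d)).real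
      {ω | ¬ ∃ x : Fin (M + 1) → Site d, (∀ i, x i ∈ box d n) ∧ (∀ i, ω ∈ percolatesAt (x i)) ∧
        ∀ i j, i ≠ j → ω ∉ openConnIn (↑(box d (2 * n)) : Set (Site d)) (x i) (x j)}) ∧
    ¬ (∃ (M : ℕ) (c : ℝ), 0 < c ∧ ∃ᶠ n : ℕ in atTop,
        c ≤ (bondPercolation (zdGraph d) (criticalProbI d)).real (repEvent d M n)ᶜ) :=
  fewClassesDim_and_not_nonProliferationDim d (by omega) (hH.twoPointBoundedRatio hd)

/-- **Unconditionally, S1(d) holds in all sufficiently high dimensions**: the Hara–Slade infrared bound (PROVED in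
the tree, `HaraSlade1990_infraredBound_holds`) gives `d₀ > 6` with `θ(p_c(ℤ^d)) = 0` for every `d ≥ d₀`
(`HaraSlade1990_infraredBound.percolationContinuity`), hence S1(d) with `M = 0`, `c = 1`.
[cite: HaraSlade1990, Thm. 1.1] [cite: HeydenreichVanDerHofstad2017, Thm. 5.1] -/
theorem exists_forall_fewClassesDim :
    ∃ d₀ : ℕ, 6 < d₀ ∧ ∀ d : ℕ, d₀ ≤ d →
      ∃ (M : ℕ) (c : ℝ), 0 < c ∧ ∃ᶠ n : ℕ in atTop, c ≤ (bondPercolation (zdGraph d) (criticalProbI d)).real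
        {ω | ¬ ∃ x : Fin (M + 1) → Site d, (∀ i, x i ∈ box d n) ∧ (∀ i, ω ∈ percolatesAt (x i)) ∧
          ∀ i j, i ≠ j → ω ∉ openConnIn (↑(box d (2 * n)) : Set (Site d)) (x i) (x j)} := by
  obtain ⟨d₀, hd₀, H⟩ := HaraSlade1990_infraredBound_holds.percolationContinuity
  exact ⟨d₀, hd₀, fun d hd => fewClassesDim_of_percolationContinuity (H d hd)⟩

/-- **The `d = 3` instance is the registered stub, and the summit implies it** (restated over the engine, so that
the calibration file is self-contained: `PercolationContinuityZ3 = PercolationContinuity 3`). -/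
theorem fewClassesDim_three_of_percolationContinuityZ3 (h : _root_.PercolationContinuityZ3) :
    ∃ (M : ℕ) (c : ℝ), 0 < c ∧ ∃ᶠ n : ℕ in atTop, c ≤ (bondPercolation (zdGraph 3) (criticalProbI 3)).real
      {ω | ¬ ∃ x : Fin (M + 1) → Site 3, (∀ i, x i ∈ box 3 n) ∧ (∀ i, ω ∈ percolatesAt (x i)) ∧
        ∀ i j, i ≠ j → ω ∉ openConnIn (↑(box 3 (2 * n)) : Set (Site 3)) (x i) (x j)} :=
  fewClassesDim_of_percolationContinuity h

end Summit.CriticalPhenomena.PercolationContinuityZ3.Theorems.NonProliferation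

end
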